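import Summits.CriticalPhenomena.PercolationContinuityZ3.Theorems.PercNearOneGluingNoHeavyLowerTailKNGoodB3Worlds
import Summits.CriticalPhenomena.PercolationContinuityZ3.Theorems.PercNearOneGluingNoHeavyLowerTailKNGoodR3CaseMid
import Summits.CriticalPhenomena.PercolationContinuityZ3.Theorems.PercNearOneGluingNoHeavyLowerTailKNGoodR3CaseTop
import HarnessLib

/-!
# `NoHeavyLowerTail` (stmt-CriticalPhenomena-4575) — EVERY SEPARATED KOZMA–NITZAN QUADRUPLE WITH THREE RELAYS IS GOOD
# (universal goodness at `|A| = 3`, arbitrary observer side)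

Support file (`--supports stmt-CriticalPhenomena-4575`, hull-port prover `prim-hp-2`, gen 21).  No definitions, no named facts,
no sorries; standard axioms.

Kozma–Nitzan (arXiv:2401.12397, §3.2 p. 12) call a quadruple `(G, A, 0, b)` — `0` and `b` separated by `A` — GOOD if
`P(0 ↔ b) ≥ min_a P(a ↔ b) − Σ_{W ∩ A = ∅} P(C(0) = W) · min_a P_{G∖W}(a ↔ b)`, and prove it for one-layer observers (Thm. 4)
and chains (Thm. 5).  The tree proved it for `|A| = 2` (every side) and for `|A| = 3` with observer sides of at most four
vertices (GC₃, Theorems A and B).  THIS FILE: **`|A| = 3`, EVERY observer side.**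

* `KNGoodB3.slack_nonneg` — with `a₃` the loneliest relay of `G` and `T`-order `s₁ ≤ s₂`:
  `0 ≤ μ(o↔b) − μ(o↔A, a₃↔b) − Σ_W max_a [μ(C(o)=W, a₃↔b) − μ(C(o)=W, a↔b)]`.  Kozma–Nitzan's `o_decomp`/(11)/(9) supply the
  designated part and the rows, `KNGoodB3.pocket_decomp` the pocket gaps, `KNGoodB3.twoWorld12b/13a/23a` (from the
  pocket-augmented BHK inequality `KNGoodPocketBHK.core2`) the B-side inequalities, and `KNGoodR3.case_top/mid/low` the real
  algebra of the three `T`-positions of `a₃`.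
* `KNGoodB3.knGood_core`, `knGood_of_min₃`, `knGood_sepData` — goodness (KN's correction term is dominated pocket by pocket via
  the spatial Markov property; relabelling by `SepData.swap12/swap23`).
* **`KNGoodB3.knGood_threeRelays`** — for distinct `a₁ a₂ a₃`, `b ∉ A`, an interior `VB ∋ o` missing `A ∪ {b}` with no
  positive pair from `VB` to the outside of `VB ∪ A`:  `KNGood w {a₁,a₂,a₃} _ o b`.
[cite: KozmaNitzan2024, §3.2 Definition (p. 12), Thms. 4–5 (pp. 12–14), Thm. 3 and its proof (pp. 10–12)]
[cite: VandenbergHaggstromKahn2005, Thm. 1.1 (pp. 3–5)]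
-/

noncomputable section

namespace Summit.CriticalPhenomena.PercolationContinuityZ3.Theorems

open MeasureTheory Set Literature.Probability.LatticeModels Literature.Probability.Percolation
open scoped Classical

namespace KNGoodB3

open KNSep KNGoodAux KNGoodPocketBHK KNGoodR3

variable {V : Type*} [Fintype V] (S : SepData V)

/-- **(9) on the `T`-side for the pair `{a₂, a₃}` and the lonely relay `a₁`**:
`min(s₂ − s₁, s₃ − s₁) ≤ q^{(23)}_2 − q^{(23)}_1`. [cite: KozmaNitzan2024, Lemma 4 / (9) (pp. 9–10), proof of Thm. 3 (p. 11)] -/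
theorem eq9T_23 :
    min (S.Q ∅ S.a₂ - S.Q ∅ S.a₁) (S.Q ∅ S.a₃ - S.Q ∅ S.a₁) ≤ S.Q S.F23 S.a₂ - S.Q S.F23 S.a₁ := by
  classical
  have hupd : Function.update (S.uT ∅) s(S.a₂, S.a₃) 1 = S.uT S.F23 := by
    funext e
    by_cases he : e = s(S.a₂, S.a₃)
    · subst he; simp [SepData.uT, SepData.F23]
    · rw [Function.update_of_ne he]; simp [SepData.uT, SepData.F23, he]
  have L4 := KozmaNitzan2024_lemma4_glued (S.uT ∅) S.a₂ S.a₃ S.a₁ S.b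
  rw [hupd] at L4
  rwa [S.Q_eq_uT ∅ S.empty_off, S.Q_eq_uT ∅ S.empty_off, S.Q_eq_uT ∅ S.empty_off,
    S.Q_eq_uT S.F23 S.F23_off, S.Q_eq_uT S.F23 S.F23_off]

/-- Members of `nullSets Afin` are disjoint from `A`. [folklore] -/
theorem disjoint_of_mem_nullSets {W : Finset V} (hW : W ∈ nullSets (Afin S)) : Disjoint (↑W : Set V) S.A := by
  rw [← coe_Afin, Finset.disjoint_coe]; exact mem_nullSets.1 hW

/-- The pocket gap `μ(C(o)=W, a₃↔b) − μ(C(o)=W, a₁↔b)` in cell form. [cite: KozmaNitzan2024, §3.2 (p. 12)] -/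
theorem gap31 {W : Finset V} (hW : W ∈ nullSets (Afin S)) :
    (prodBernoulli S.w).real (clusterIs S.o W ∩ openConn S.a₃ S.b) -
        (prodBernoulli S.w).real (clusterIs S.o W ∩ openConn S.a₁ S.b) =
      (S.Q ∅ S.a₃ - S.Q ∅ S.a₁) * pk S S.cM W - (S.Q S.F12 S.a₁ - S.Q S.F12 S.a₃) * pk S S.c12 W +
        (S.Q S.F23 S.a₂ - S.Q S.F23 S.a₁) * pk S S.c23 W := by
  have hd := disjoint_of_mem_nullSets S hW
  rw [pocket_decomp S S.ha₃ hd, pocket_decomp S S.ha₁ hd, S.Q123_13, S.Q13_13, ← S.Q23_23]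
  ring

/-- The pocket gap `μ(C(o)=W, a₃↔b) − μ(C(o)=W, a₂↔b)` in cell form. [cite: KozmaNitzan2024, §3.2 (p. 12)] -/
theorem gap32 {W : Finset V} (hW : W ∈ nullSets (Afin S)) :
    (prodBernoulli S.w).real (clusterIs S.o W ∩ openConn S.a₃ S.b) -
        (prodBernoulli S.w).real (clusterIs S.o W ∩ openConn S.a₂ S.b) =
      (S.Q ∅ S.a₃ - S.Q ∅ S.a₂) * pk S S.cM W - (S.Q S.F12 S.a₁ - S.Q S.F12 S.a₃) * pk S S.c12 W +
        (S.Q S.F13 S.a₁ - S.Q S.F13 S.a₂) * pk S S.c13 W := by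
  have hd := disjoint_of_mem_nullSets S hW
  rw [pocket_decomp S S.ha₃ hd, pocket_decomp S S.ha₂ hd, S.Q123_23, ← S.Q12_12, S.Q23_23, ← S.Q13_13]
  ring

/-- **THE SLACK IS NONNEGATIVE** (relay `a₃` the loneliest of `G`, `T`-order `s₁ ≤ s₂`):
`0 ≤ μ(o↔b) − μ(o↔A, a₃↔b) − Σ_W max_a [μ(C(o)=W, a₃↔b) − μ(C(o)=W, a↔b)]` — the three `T`-positions of `a₃` are the
three cases of `KNGoodR3`. [cite: KozmaNitzan2024, §3.2 (p. 12), proof of Thm. 3 (pp. 10–12)] -/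
theorem slack_nonneg (h31 : (prodBernoulli S.w).real (openConn S.a₃ S.b) ≤ (prodBernoulli S.w).real (openConn S.a₁ S.b))
    (h32 : (prodBernoulli S.w).real (openConn S.a₃ S.b) ≤ (prodBernoulli S.w).real (openConn S.a₂ S.b))
    (h12 : S.Q ∅ S.a₁ ≤ S.Q ∅ S.a₂) :
    0 ≤ (prodBernoulli S.w).real (openConn S.o S.b) - (prodBernoulli S.w).real (S.oA ∩ openConn S.a₃ S.b) -
      ∑ W ∈ nullSets (Afin S), max 0 (max
        ((prodBernoulli S.w).real (clusterIs S.o W ∩ openConn S.a₃ S.b) -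
          (prodBernoulli S.w).real (clusterIs S.o W ∩ openConn S.a₁ S.b))
        ((prodBernoulli S.w).real (clusterIs S.o W ∩ openConn S.a₃ S.b) -
          (prodBernoulli S.w).real (clusterIs S.o W ∩ openConn S.a₂ S.b))) := by
  classical
  -- the designated part (KN's o_decomp) and the pocket gaps in cell form
  rw [S.o_decomp, ← S.Q23_23, ← S.Q13_13]
  have hsum : ∑ W ∈ nullSets (Afin S), max 0 (max
        ((prodBernoulli S.w).real (clusterIs S.o W ∩ openConn S.a₃ S.b) - (prodBernoulli S.w).real (clusterIs S.o W ∩ openConn S.a₁ S.b))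
        ((prodBernoulli S.w).real (clusterIs S.o W ∩ openConn S.a₃ S.b) - (prodBernoulli S.w).real (clusterIs S.o W ∩ openConn S.a₂ S.b))) =
      ∑ W ∈ nullSets (Afin S), max 0 (max
        ((S.Q ∅ S.a₃ - S.Q ∅ S.a₁) * pk S S.cM W - (S.Q S.F12 S.a₁ - S.Q S.F12 S.a₃) * pk S S.c12 W + (S.Q S.F23 S.a₂ - S.Q S.F23 S.a₁) * pk S S.c23 W)
        ((S.Q ∅ S.a₃ - S.Q ∅ S.a₂) * pk S S.cM W - (S.Q S.F12 S.a₁ - S.Q S.F12 S.a₃) * pk S S.c12 W + (S.Q S.F13 S.a₁ - S.Q S.F13 S.a₂) * pk S S.c13 W)) :=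
    Finset.sum_congr rfl fun W hW => by rw [gap31 S hW, gap32 S hW]
  rw [hsum, ← Finset.sum_coe_sort (nullSets (Afin S))]
  -- families of the index type of pockets
  have fam_sub : ∀ 𝒬 : Finset ↥(nullSets (Afin S)), 𝒬.map (Function.Embedding.subtype _) ⊆ nullSets (Afin S) :=
    fun 𝒬 W hW => by
      obtain ⟨i, -, rfl⟩ := Finset.mem_map.1 hW
      exact i.2
  have fam_sum : ∀ (𝒬 : Finset ↥(nullSets (Afin S))) (f : Finset V → ℝ),
      ∑ i ∈ 𝒬, f i = ∑ W ∈ 𝒬.map (Function.Embedding.subtype _), f W :=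
    fun 𝒬 f => (Finset.sum_map 𝒬 (Function.Embedding.subtype _) f).symm
  have sub_le : ∀ (𝒬 : Finset ↥(nullSets (Afin S))) (Φ : (V → V → Prop) → Prop),
      ∑ i ∈ 𝒬, pk S Φ i ≤ ∑ W ∈ nullSets (Afin S), pk S Φ W := fun 𝒬 Φ => by
    rw [fam_sum]
    exact Finset.sum_le_sum_of_subset_of_nonneg (fam_sub 𝒬) fun W _ _ => pk_nonneg S Φ W
  have pk0 : ∀ (Φ : (V → V → Prop) → Prop) (i : ↥(nullSets (Afin S))), 0 ≤ pk S Φ i := fun Φ i => pk_nonneg S Φ i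
  -- world partitions and the induced bounds
  have tM := QM_split S
  have t12 := Q12_split S
  have t13 := Q13_split S
  have t23 := Q23_split S
  have n_md1 : 0 ≤ (prodBernoulli S.w).real (S.ev fun r => S.cM r ∧ r S.o S.a₁) := measureReal_nonneg
  have n_md2 : 0 ≤ (prodBernoulli S.w).real (S.ev fun r => S.cM r ∧ r S.o S.a₂) := measureReal_nonneg
  have n_md3 : 0 ≤ (prodBernoulli S.w).real (S.ev fun r => S.cM r ∧ r S.o S.a₃) := measureReal_nonneg
  have n_m12_1 : 0 ≤ (prodBernoulli S.w).real (S.ev fun r => S.c12 r ∧ r S.o S.a₁) := measureReal_nonneg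
  have n_m12_3 : 0 ≤ (prodBernoulli S.w).real (S.ev fun r => S.c12 r ∧ r S.o S.a₃) := measureReal_nonneg
  have n_m13_1 : 0 ≤ (prodBernoulli S.w).real (S.ev fun r => S.c13 r ∧ r S.o S.a₁) := measureReal_nonneg
  have n_m13_2 : 0 ≤ (prodBernoulli S.w).real (S.ev fun r => S.c13 r ∧ r S.o S.a₂) := measureReal_nonneg
  have n_m23_1 : 0 ≤ (prodBernoulli S.w).real (S.ev fun r => S.c23 r ∧ r S.o S.a₁) := measureReal_nonneg
  have n_m23_2 : 0 ≤ (prodBernoulli S.w).real (S.ev fun r => S.c23 r ∧ r S.o S.a₂) := measureReal_nonneg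
  have hTd12 : ∀ 𝒬 : Finset ↥(nullSets (Afin S)), (prodBernoulli S.w).real (S.ev fun r => S.cM r ∧ r S.o S.a₁) + (prodBernoulli S.w).real (S.ev fun r => S.cM r ∧ r S.o S.a₂) + ∑ i ∈ 𝒬, pk S S.cM i ≤ (prodBernoulli S.w).real (S.ev S.cM) :=
    fun 𝒬 => by linarith [sub_le 𝒬 S.cM]
  have hT12_1 : ∀ 𝒬 : Finset ↥(nullSets (Afin S)), (prodBernoulli S.w).real (S.ev fun r => S.c12 r ∧ r S.o S.a₁) + ∑ i ∈ 𝒬, pk S S.c12 i ≤ (prodBernoulli S.w).real (S.ev S.c12) :=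
    fun 𝒬 => by linarith [sub_le 𝒬 S.c12]
  have hT13_2 : ∀ 𝒬 : Finset ↥(nullSets (Afin S)), (prodBernoulli S.w).real (S.ev fun r => S.c13 r ∧ r S.o S.a₂) + ∑ i ∈ 𝒬, pk S S.c13 i ≤ (prodBernoulli S.w).real (S.ev S.c13) :=
    fun 𝒬 => by linarith [sub_le 𝒬 S.c13]
  have hT23_1 : ∀ 𝒬 : Finset ↥(nullSets (Afin S)), (prodBernoulli S.w).real (S.ev fun r => S.c23 r ∧ r S.o S.a₁) + ∑ i ∈ 𝒬, pk S S.c23 i ≤ (prodBernoulli S.w).real (S.ev S.c23) :=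
    fun 𝒬 => by linarith [sub_le 𝒬 S.c23]
  have hdeg : (prodBernoulli S.w).real (S.ev S.cM) = 0 → ((prodBernoulli S.w).real (S.ev S.c12) = 0 ∧ (prodBernoulli S.w).real (S.ev S.c13) = 0) ∨ ((prodBernoulli S.w).real (S.ev S.c12) = 0 ∧ (prodBernoulli S.w).real (S.ev S.c23) = 0) ∨ ((prodBernoulli S.w).real (S.ev S.c13) = 0 ∧ (prodBernoulli S.w).real (S.ev S.c23) = 0) :=
    worlds_degenerate S
  have hdeg' : (prodBernoulli S.w).real (S.ev S.cM) = 0 → ((prodBernoulli S.w).real (S.ev S.c13) = 0 ∧ (prodBernoulli S.w).real (S.ev S.c12) = 0) ∨ ((prodBernoulli S.w).real (S.ev S.c13) = 0 ∧ (prodBernoulli S.w).real (S.ev S.c23) = 0) ∨ ((prodBernoulli S.w).real (S.ev S.c12) = 0 ∧ (prodBernoulli S.w).real (S.ev S.c23) = 0) :=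
    fun h => by rcases hdeg h with ⟨a, b⟩ | ⟨a, b⟩ | ⟨a, b⟩ <;> tauto
  have hdeg'' : (prodBernoulli S.w).real (S.ev S.cM) = 0 → ((prodBernoulli S.w).real (S.ev S.c13) = 0 ∧ (prodBernoulli S.w).real (S.ev S.c23) = 0) ∨ ((prodBernoulli S.w).real (S.ev S.c13) = 0 ∧ (prodBernoulli S.w).real (S.ev S.c12) = 0) ∨ ((prodBernoulli S.w).real (S.ev S.c23) = 0 ∧ (prodBernoulli S.w).real (S.ev S.c12) = 0) :=
    fun h => by rcases hdeg h with ⟨a, b⟩ | ⟨a, b⟩ | ⟨a, b⟩ <;> tauto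
  -- the two-world inequalities on families of the index type
  have hI12b : ∀ 𝒬 : Finset ↥(nullSets (Afin S)),
      (prodBernoulli S.w).real (S.ev S.c12) * ((prodBernoulli S.w).real (S.ev fun r => S.cM r ∧ r S.o S.a₁) + (prodBernoulli S.w).real (S.ev fun r => S.cM r ∧ r S.o S.a₂) + ∑ i ∈ 𝒬, pk S S.cM i) ≤ (prodBernoulli S.w).real (S.ev S.cM) * ((prodBernoulli S.w).real (S.ev fun r => S.c12 r ∧ r S.o S.a₁) + ∑ i ∈ 𝒬, pk S S.c12 i) :=
    fun 𝒬 => by rw [fam_sum, fam_sum]; exact twoWorld12b S (fam_sub 𝒬)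
  have hI13a : ∀ 𝒬 : Finset ↥(nullSets (Afin S)),
      (prodBernoulli S.w).real (S.ev S.cM) * ((prodBernoulli S.w).real (S.ev fun r => S.c13 r ∧ r S.o S.a₂) + ∑ i ∈ 𝒬, pk S S.c13 i) ≤ (prodBernoulli S.w).real (S.ev S.c13) * ((prodBernoulli S.w).real (S.ev fun r => S.cM r ∧ r S.o S.a₂) + ∑ i ∈ 𝒬, pk S S.cM i) :=
    fun 𝒬 => by rw [fam_sum, fam_sum]; exact twoWorld13a S (fam_sub 𝒬)
  have hI23a : ∀ 𝒬 : Finset ↥(nullSets (Afin S)),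
      (prodBernoulli S.w).real (S.ev S.cM) * ((prodBernoulli S.w).real (S.ev fun r => S.c23 r ∧ r S.o S.a₁) + ∑ i ∈ 𝒬, pk S S.c23 i) ≤ (prodBernoulli S.w).real (S.ev S.c23) * ((prodBernoulli S.w).real (S.ev fun r => S.cM r ∧ r S.o S.a₁) + ∑ i ∈ 𝒬, pk S S.cM i) :=
    fun 𝒬 => by rw [fam_sum, fam_sum]; exact twoWorld23a S (fam_sub 𝒬)
  -- the loneliness rows (KN (11)) and the `T`-side gluing gains (KN (9))
  have r1 := S.eq11
  have r2 := S.eq11'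
  rw [← S.Q23_23] at r1
  rw [← S.Q13_13] at r2
  have g12 := S.eq9T
  have g23 := eq9T_23 S
  have hQd : 0 ≤ (prodBernoulli S.w).real (S.ev S.cM) := measureReal_nonneg
  have hQ12 : 0 ≤ (prodBernoulli S.w).real (S.ev S.c12) := measureReal_nonneg
  have hQ13 : 0 ≤ (prodBernoulli S.w).real (S.ev S.c13) := measureReal_nonneg
  have hQ23 : 0 ≤ (prodBernoulli S.w).real (S.ev S.c23) := measureReal_nonneg
  -- three cases by the `T`-rank of `a₃`
  rcases le_total (S.Q ∅ S.a₂) (S.Q ∅ S.a₃) with h23 | h32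
  · -- `s₁ ≤ s₂ ≤ s₃`: `a₃` is the `T`-top relay
    have hδ : 0 ≤ (S.Q S.F23 S.a₂ - S.Q S.F23 S.a₁) := le_trans (le_min (by linarith) (by linarith)) g23
    have key := case_top (ι := ↥(nullSets (Afin S))) (S.Q ∅ S.a₂ - S.Q ∅ S.a₁) (S.Q ∅ S.a₃ - S.Q ∅ S.a₂) (S.Q S.F13 S.a₁ - S.Q S.F13 S.a₂) (S.Q S.F23 S.a₂ - S.Q S.F23 S.a₁) (S.Q S.F12 S.a₁ - S.Q S.F12 S.a₃) _ _ _ _ _ _ _ _ _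
      (fun i => pk S S.cM i) (fun i => pk S S.c12 i) (fun i => pk S S.c13 i) (fun i => pk S S.c23 i)
      (by linarith) (by linarith) hδ hQd hQ12 hQ13 hQ23 n_md1 n_md2 n_m12_1 n_m13_2 n_m23_1
      (pk0 S.cM) (pk0 S.c12) (pk0 S.c13) (pk0 S.c23) hTd12 hT12_1 hT13_2 hT23_1 hdeg hI12b hI13a hI23a
      (by linarith) (by linarith)
    have e : ∀ i : ↥(nullSets (Afin S)),
        max 0 (max ((S.Q ∅ S.a₃ - S.Q ∅ S.a₁) * pk S S.cM i - (S.Q S.F12 S.a₁ - S.Q S.F12 S.a₃) * pk S S.c12 i + (S.Q S.F23 S.a₂ - S.Q S.F23 S.a₁) * pk S S.c23 i)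
          ((S.Q ∅ S.a₃ - S.Q ∅ S.a₂) * pk S S.cM i - (S.Q S.F12 S.a₁ - S.Q S.F12 S.a₃) * pk S S.c12 i + (S.Q S.F13 S.a₁ - S.Q S.F13 S.a₂) * pk S S.c13 i)) =
        max 0 (max ((S.Q ∅ S.a₂ - S.Q ∅ S.a₁ + (S.Q ∅ S.a₃ - S.Q ∅ S.a₂)) * pk S S.cM i - (S.Q S.F12 S.a₁ - S.Q S.F12 S.a₃) * pk S S.c12 i + (S.Q S.F23 S.a₂ - S.Q S.F23 S.a₁) * pk S S.c23 i)
          ((S.Q ∅ S.a₃ - S.Q ∅ S.a₂) * pk S S.cM i - (S.Q S.F12 S.a₁ - S.Q S.F12 S.a₃) * pk S S.c12 i + (S.Q S.F13 S.a₁ - S.Q S.F13 S.a₂) * pk S S.c13 i)) := by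
      intro i; congr 1; congr 1; ring
    simp only [← e] at key
    linarith [key]
  rcases le_total (S.Q ∅ S.a₁) (S.Q ∅ S.a₃) with h13 | h31'
  · -- `s₁ ≤ s₃ ≤ s₂`: `a₃` is the `T`-middle relay (labels `(1,2,3) ↦ (a₁,a₃,a₂)`)
    have hδ : 0 ≤ (S.Q S.F23 S.a₂ - S.Q S.F23 S.a₁) := le_trans (le_min (by linarith) (by linarith)) g23
    have key := case_mid (ι := ↥(nullSets (Afin S))) (S.Q ∅ S.a₃ - S.Q ∅ S.a₁) (S.Q ∅ S.a₂ - S.Q ∅ S.a₃) (S.Q S.F12 S.a₁ - S.Q S.F12 S.a₃) (S.Q S.F23 S.a₂ - S.Q S.F23 S.a₁) (S.Q S.F13 S.a₁ - S.Q S.F13 S.a₂) _ _ _ _ _ _ _ _ _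
      (fun i => pk S S.cM i) (fun i => pk S S.c13 i) (fun i => pk S S.c12 i) (fun i => pk S S.c23 i)
      (by linarith) (by linarith) hδ hQd hQ13 hQ12 hQ23 n_md1 n_md2 n_m13_2 n_m12_1 n_m23_1
      (pk0 S.cM) (pk0 S.c13) (pk0 S.c12) (pk0 S.c23) hTd12 hT13_2 hT12_1 hT23_1 hdeg' hI12b hI13a hI23a
      (by linarith) (by linarith)
    have e : ∀ i : ↥(nullSets (Afin S)),
        max 0 (max ((S.Q ∅ S.a₃ - S.Q ∅ S.a₁) * pk S S.cM i - (S.Q S.F12 S.a₁ - S.Q S.F12 S.a₃) * pk S S.c12 i + (S.Q S.F23 S.a₂ - S.Q S.F23 S.a₁) * pk S S.c23 i)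
          ((S.Q ∅ S.a₃ - S.Q ∅ S.a₂) * pk S S.cM i - (S.Q S.F12 S.a₁ - S.Q S.F12 S.a₃) * pk S S.c12 i + (S.Q S.F13 S.a₁ - S.Q S.F13 S.a₂) * pk S S.c13 i)) =
        max 0 (max ((S.Q ∅ S.a₃ - S.Q ∅ S.a₁) * pk S S.cM i - (S.Q S.F12 S.a₁ - S.Q S.F12 S.a₃) * pk S S.c12 i + (S.Q S.F23 S.a₂ - S.Q S.F23 S.a₁) * pk S S.c23 i)
          (-(S.Q ∅ S.a₂ - S.Q ∅ S.a₃) * pk S S.cM i + (S.Q S.F13 S.a₁ - S.Q S.F13 S.a₂) * pk S S.c13 i - (S.Q S.F12 S.a₁ - S.Q S.F12 S.a₃) * pk S S.c12 i)) := by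
      intro i; congr 1; congr 1; ring
    simp only [← e] at key
    linarith [key]
  · -- `s₃ ≤ s₁ ≤ s₂`: `a₃` is the `T`-lowest relay (labels `(1,2,3) ↦ (a₃,a₁,a₂)`)
    have hε : 0 ≤ (S.Q S.F12 S.a₁ - S.Q S.F12 S.a₃) := le_trans (le_min (by linarith) (by linarith)) g12
    have key := case_low (ι := ↥(nullSets (Afin S))) (S.Q ∅ S.a₁ - S.Q ∅ S.a₃) (S.Q ∅ S.a₂ - S.Q ∅ S.a₁) (S.Q S.F23 S.a₂ - S.Q S.F23 S.a₁) (S.Q S.F12 S.a₁ - S.Q S.F12 S.a₃) (S.Q S.F13 S.a₁ - S.Q S.F13 S.a₂) _ _ _ _ _ _ _ _ _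
      (fun i => pk S S.cM i) (fun i => pk S S.c13 i) (fun i => pk S S.c23 i) (fun i => pk S S.c12 i)
      (by linarith) (by linarith) hε hQd hQ13 hQ23 hQ12 n_md1 n_md2 n_m13_2 n_m23_1 n_m12_1
      (pk0 S.cM) (pk0 S.c13) (pk0 S.c23) (pk0 S.c12) hTd12 hT13_2 hT23_1 hT12_1 hdeg'' hI23a hI13a hI12b
      (by linarith) (by linarith)
    have e : ∀ i : ↥(nullSets (Afin S)),
        max 0 (max ((S.Q ∅ S.a₃ - S.Q ∅ S.a₁) * pk S S.cM i - (S.Q S.F12 S.a₁ - S.Q S.F12 S.a₃) * pk S S.c12 i + (S.Q S.F23 S.a₂ - S.Q S.F23 S.a₁) * pk S S.c23 i)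
          ((S.Q ∅ S.a₃ - S.Q ∅ S.a₂) * pk S S.cM i - (S.Q S.F12 S.a₁ - S.Q S.F12 S.a₃) * pk S S.c12 i + (S.Q S.F13 S.a₁ - S.Q S.F13 S.a₂) * pk S S.c13 i)) =
        max 0 (max (-(S.Q ∅ S.a₁ - S.Q ∅ S.a₃) * pk S S.cM i + (S.Q S.F23 S.a₂ - S.Q S.F23 S.a₁) * pk S S.c23 i - (S.Q S.F12 S.a₁ - S.Q S.F12 S.a₃) * pk S S.c12 i)
          (-(S.Q ∅ S.a₁ - S.Q ∅ S.a₃ + (S.Q ∅ S.a₂ - S.Q ∅ S.a₁)) * pk S S.cM i + (S.Q S.F13 S.a₁ - S.Q S.F13 S.a₂) * pk S S.c13 i - (S.Q S.F12 S.a₁ - S.Q S.F12 S.a₃) * pk S S.c12 i)) := by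
      intro i; congr 1; congr 1 <;> ring
    simp only [← e] at key
    linarith [key]

/-- **The pocket correction dominates**: for a hairless pocket `W`,
`μ(C(o)=W, a₃↔b) − max_a[μ(C(o)=W, a₃↔b) − μ(C(o)=W, a↔b)] ≤ μ(C(o)=W) · min_a P_{G∖W}(a↔b)`
(spatial Markov property `KNGoodAux.real_clusterIs_inter_openConn`). [cite: KozmaNitzan2024, §3.2 (p. 12)] -/
theorem pocket_inf_ge {W : Finset V} (hW : W ∈ nullSets (Afin S)) :
    (prodBernoulli S.w).real (clusterIs S.o W ∩ openConn S.a₃ S.b) - max 0 (max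
        ((prodBernoulli S.w).real (clusterIs S.o W ∩ openConn S.a₃ S.b) - (prodBernoulli S.w).real (clusterIs S.o W ∩ openConn S.a₁ S.b))
        ((prodBernoulli S.w).real (clusterIs S.o W ∩ openConn S.a₃ S.b) - (prodBernoulli S.w).real (clusterIs S.o W ∩ openConn S.a₂ S.b))) ≤
      (prodBernoulli S.w).real (clusterIs S.o W) *
        (Afin S).inf' (Afin_nonempty S) (fun a => (prodBernoulli S.w).real (openConnIn ((↑W : Set V)ᶜ) a S.b)) := by
  classical
  obtain ⟨a, ha, heq⟩ := Finset.exists_mem_eq_inf' (Afin_nonempty S)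
    (fun a => (prodBernoulli S.w).real (openConnIn ((↑W : Set V)ᶜ) a S.b))
  rw [heq]
  have haW : a ∉ W := fun h => Finset.disjoint_left.1 (mem_nullSets.1 hW) h ha
  rw [← real_clusterIs_inter_openConn S.w S.o W haW S.b]
  set M₀ := max 0 (max
        ((prodBernoulli S.w).real (clusterIs S.o W ∩ openConn S.a₃ S.b) - (prodBernoulli S.w).real (clusterIs S.o W ∩ openConn S.a₁ S.b))
        ((prodBernoulli S.w).real (clusterIs S.o W ∩ openConn S.a₃ S.b) - (prodBernoulli S.w).real (clusterIs S.o W ∩ openConn S.a₂ S.b))) with hM₀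
  have h0 : 0 ≤ M₀ := le_max_left _ _
  have h1 : (prodBernoulli S.w).real (clusterIs S.o W ∩ openConn S.a₃ S.b) - (prodBernoulli S.w).real (clusterIs S.o W ∩ openConn S.a₁ S.b) ≤ M₀ :=
    le_max_of_le_right (le_max_left _ _)
  have h2 : (prodBernoulli S.w).real (clusterIs S.o W ∩ openConn S.a₃ S.b) - (prodBernoulli S.w).real (clusterIs S.o W ∩ openConn S.a₂ S.b) ≤ M₀ :=
    le_max_of_le_right (le_max_right _ _)
  rcases (mem_Afin S).1 ha with rfl | rfl | rfl
  · linarith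
  · linarith
  · linarith

/-- **Goodness when `a₃` is the loneliest relay** (and the `T`-order is `s₁ ≤ s₂`).
[cite: KozmaNitzan2024, §3.2 Definition (p. 12)] -/
theorem knGood_core (h31 : (prodBernoulli S.w).real (openConn S.a₃ S.b) ≤ (prodBernoulli S.w).real (openConn S.a₁ S.b))
    (h32 : (prodBernoulli S.w).real (openConn S.a₃ S.b) ≤ (prodBernoulli S.w).real (openConn S.a₂ S.b)) (h12 : S.Q ∅ S.a₁ ≤ S.Q ∅ S.a₂) :
    KNGood S.w (Afin S) (Afin_nonempty S) S.o S.b := by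
  classical
  unfold KNGood
  have hslack := slack_nonneg S h31 h32 h12
  have h1 : (Afin S).inf' (Afin_nonempty S) (fun a => (prodBernoulli S.w).real (openConn a S.b)) ≤ (prodBernoulli S.w).real (openConn S.a₃ S.b) :=
    Finset.inf'_le _ (a₃_mem_Afin S)
  have h2 : ∑ W ∈ nullSets (Afin S), ((prodBernoulli S.w).real (clusterIs S.o W ∩ openConn S.a₃ S.b) - max 0 (max
        ((prodBernoulli S.w).real (clusterIs S.o W ∩ openConn S.a₃ S.b) - (prodBernoulli S.w).real (clusterIs S.o W ∩ openConn S.a₁ S.b))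
        ((prodBernoulli S.w).real (clusterIs S.o W ∩ openConn S.a₃ S.b) - (prodBernoulli S.w).real (clusterIs S.o W ∩ openConn S.a₂ S.b)))) ≤
      ∑ W ∈ nullSets (Afin S), (prodBernoulli S.w).real (clusterIs S.o W) *
        (Afin S).inf' (Afin_nonempty S) (fun a => (prodBernoulli S.w).real (openConnIn ((↑W : Set V)ᶜ) a S.b)) :=
    Finset.sum_le_sum fun W hW => pocket_inf_ge S hW
  rw [Finset.sum_sub_distrib] at h2
  -- `μ(a₃ ↔ b) = μ(o ↔ A, a₃ ↔ b) + Σ_W μ(C(o) = W, a₃ ↔ b)`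
  have h3 : (prodBernoulli S.w).real (openConn S.a₃ S.b) = (prodBernoulli S.w).real (S.oA ∩ openConn S.a₃ S.b) +
      ∑ W ∈ nullSets (Afin S), (prodBernoulli S.w).real (clusterIs S.o W ∩ openConn S.a₃ S.b) := by
    rw [sum_real_clusterIs_inter S.w (Afin S) S.o (openConn S.a₃ S.b),
      ← measureReal_union _ MeasurableSet.of_discrete]
    · congr 1
      ext ω
      simp only [Set.mem_union, Set.mem_inter_iff, Set.mem_setOf_eq, SepData.mem_oA_iff, mem_Afin]
      constructor
      · intro h
        by_cases hA : ∃ a ∈ S.A, (openGraph ω).Reachable S.o a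
        · exact Or.inl ⟨hA, h⟩
        · refine Or.inr ⟨fun a ha => ?_, h⟩
          have haA : a ∈ S.A := by rcases ha with rfl | rfl | rfl <;> simp [SepData.A]
          exact fun hr => hA ⟨a, haA, hr⟩
      · rintro (⟨-, h⟩ | ⟨-, h⟩) <;> exact h
    · rw [Set.disjoint_left]
      rintro ω ⟨hoA, -⟩ ⟨hno, -⟩
      obtain ⟨a, haA, hr⟩ := (S.mem_oA_iff ω).1 hoA
      have : a = S.a₁ ∨ a = S.a₂ ∨ a = S.a₃ := by simpa [SepData.A] using haA
      exact hno a ((mem_Afin S).2 this) hr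
  linarith

/-! #### Relabelling the relays -/

omit [Fintype V] in
/-- `Afin` is invariant under exchanging `a₁, a₂`. [folklore] -/
theorem Afin_swap12 : Afin S.swap12 = Afin S := by
  show ({S.a₂, S.a₁, S.a₃} : Finset V) = {S.a₁, S.a₂, S.a₃}
  exact Finset.insert_comm _ _ _

omit [Fintype V] in
/-- `Afin` is invariant under exchanging `a₂, a₃`. [folklore] -/
theorem Afin_swap23 : Afin S.swap23 = Afin S := by
  show ({S.a₁, S.a₃, S.a₂} : Finset V) = {S.a₁, S.a₂, S.a₃}
  rw [Finset.pair_comm]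

omit [Fintype V] in
/-- The `T`-quantities do not see the labelling of the relays. [folklore] -/
theorem Q_swap12 (F : Set (Sym2 V)) (x : V) : S.swap12.Q F x = S.Q F x := by
  have hA : S.swap12.A = S.A := S.A_swap12
  show (prodBernoulli S.w).real {ω | rT S.VB S.swap12.A F ω x S.b} = (prodBernoulli S.w).real {ω | rT S.VB S.A F ω x S.b}
  rw [hA]

omit [Fintype V] in
/-- Goodness does not depend on the presentation of the relay set. [folklore] -/
theorem knGood_congr_Afin [Fintype V] {w : Sym2 V → unitInterval} {A A' : Finset V} (h : A = A') (hA : A.Nonempty)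
    (hA' : A'.Nonempty) (o b : V) : KNGood w A hA o b ↔ KNGood w A' hA' o b := by
  subst h; exact Iff.rfl

/-- **Goodness when `a₃` is the loneliest relay** (any `T`-order). [cite: KozmaNitzan2024, §3.2 (p. 12)] -/
theorem knGood_of_min₃ (h31 : (prodBernoulli S.w).real (openConn S.a₃ S.b) ≤ (prodBernoulli S.w).real (openConn S.a₁ S.b))
    (h32 : (prodBernoulli S.w).real (openConn S.a₃ S.b) ≤ (prodBernoulli S.w).real (openConn S.a₂ S.b)) :
    KNGood S.w (Afin S) (Afin_nonempty S) S.o S.b := by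
  rcases le_total (S.Q ∅ S.a₁) (S.Q ∅ S.a₂) with h12 | h21
  · exact knGood_core S h31 h32 h12
  · have h := knGood_core S.swap12 h32 h31 (by rw [Q_swap12, Q_swap12]; exact h21)
    exact (knGood_congr_Afin (Afin_swap12 S) _ (Afin_nonempty S) _ _).1 h

/-- **UNIVERSAL GOODNESS FOR THREE RELAYS (structure form).**  Every separated Kozma–Nitzan quadruple `S` with
`|A| = 3` is good, for an ARBITRARY observer side. [cite: KozmaNitzan2024, §3.2 Definition (p. 12), Thms. 4–5 (pp. 12–13)] -/
theorem knGood_sepData : KNGood S.w (Afin S) (Afin_nonempty S) S.o S.b := by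
  by_cases h31 : (prodBernoulli S.w).real (openConn S.a₃ S.b) ≤ (prodBernoulli S.w).real (openConn S.a₁ S.b)
  · by_cases h32 : (prodBernoulli S.w).real (openConn S.a₃ S.b) ≤ (prodBernoulli S.w).real (openConn S.a₂ S.b)
    · exact knGood_of_min₃ S h31 h32
    · -- `a₂` is the loneliest: relabel by `swap23`
      have h32' := le_of_lt (not_le.1 h32)
      have h := knGood_of_min₃ S.swap23 (le_trans h32' h31) h32'
      exact (knGood_congr_Afin (Afin_swap23 S) _ (Afin_nonempty S) _ _).1 h
  · have h13 := le_of_lt (not_le.1 h31)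
    by_cases h12 : (prodBernoulli S.w).real (openConn S.a₁ S.b) ≤ (prodBernoulli S.w).real (openConn S.a₂ S.b)
    · -- `a₁` is the loneliest: relabel by `swap12` then `swap23`
      have h := knGood_of_min₃ S.swap12.swap23 h12 h13
      have e : Afin S.swap12.swap23 = Afin S := (Afin_swap23 S.swap12).trans (Afin_swap12 S)
      exact (knGood_congr_Afin e _ (Afin_nonempty S) _ _).1 h
    · -- `a₂` is the loneliest
      have h21 := le_of_lt (not_le.1 h12)
      have h := knGood_of_min₃ S.swap23 h21 (le_trans h21 h13)
      exact (knGood_congr_Afin (Afin_swap23 S) _ (Afin_nonempty S) _ _).1 h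

/-- **THEOREM (universal goodness at `|A| = 3`).**  Let `A = {a₁, a₂, a₃}` be three distinct vertices, `b ∉ A`, and
let `VB ∋ o` be a set of vertices missing `A` and `b` such that every pair from `VB` to the outside of `VB ∪ A` has weight
zero (removing `A` separates `o` from `b`).  Then the quadruple `(G, A, o, b)` is GOOD in the sense of Kozma–Nitzan:
`P(o ↔ b) ≥ min_a P(a ↔ b) − Σ_{W ∩ A = ∅} P(C(o) = W) · min_a P_{G∖W}(a ↔ b)` — for EVERY observer side (Kozma–Nitzan
prove the one-layer and chain cases, Thms. 4–5; the tree's earlier files the sides with at most four vertices).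
Proof: the pocket-augmented BHK inequality (`KNGoodPocketBHK.core2`) ⇒ the two-world B-side inequalities
(`KNGoodB3.two_world`) ⇒ the reduction R3 (`KNGoodR3.case_*`, `KNGoodB3.slack_nonneg`).
[cite: KozmaNitzan2024, §3.2 Definition (p. 12), Thms. 4–5 (pp. 12–14), Thm. 3 (p. 10)]
[cite: VandenbergHaggstromKahn2005, Thm. 1.1 (pp. 3–5)] -/
theorem knGood_threeRelays (w : Sym2 V → unitInterval) (VB : Set V) (o b a₁ a₂ a₃ : V) (ho : o ∈ VB) (hb : b ∉ VB)
    (ha₁ : a₁ ∉ VB) (ha₂ : a₂ ∉ VB) (ha₃ : a₃ ∉ VB) (h₁₂ : a₁ ≠ a₂) (h₁₃ : a₁ ≠ a₃) (h₂₃ : a₂ ≠ a₃)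
    (hb₁ : b ≠ a₁) (hb₂ : b ≠ a₂) (hb₃ : b ≠ a₃)
    (hcut : ∀ e, e ∉ sideB VB ({a₁, a₂, a₃} : Set V) → e ∉ sideT VB ({a₁, a₂, a₃} : Set V) → w e = 0) :
    KNGood w ({a₁, a₂, a₃} : Finset V) ⟨a₁, by simp⟩ o b :=
  knGood_sepData ⟨w, VB, o, b, a₁, a₂, a₃, ho, hb, ha₁, ha₂, ha₃, h₁₂, h₁₃, h₂₃, hb₁, hb₂, hb₃, hcut⟩

end KNGoodB3

end Summit.CriticalPhenomena.PercolationContinuityZ3.Theorems
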